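/-
Copyright (c) 2026 the pub-hodgecm-mathlib formalisation cell (harness21).  Prover seat hodgecm-mathlib-K2Liu-p05 (g3), 2026-09-04
(Track B «K2-LIT», crux hLiu418 = stmt-HodgeConjecture-24832, socket #42F′, ROAD I v3, organ G2-Weil, sub-organ (G2-W2) sequel: the hypothesis-free instance).
-/
import Summits.HodgeConjecture.HodgeConjecture.Theorems.K2LiuWeilDatumSmoothU22                -- (G2-W2): `contDiffAt_weilDatum_inl`, letter derivatives
import Literature.RepresentationTheory.KonnoKonno2007.JunctionWeilDatumGeneralRank            -- ★ the hypothesis-free junction datum `weilRep ∘ toBig` + KK Lemma 5.2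
import HarnessLib

/-!
# (G2-W2, sequel) The hypothesis-free instance: smoothness and letter derivatives of the tree's junction Weil representation of `U(2,2) × U(R,S)`

Track B ∕ K2-LIT, hLiu418 = stmt-HodgeConjecture-24832, #42F′ ROAD I v3 organ G2-Weil, sub-organ (G2-W2).  Namespace
`Summit.HodgeConjecture.HodgeConjecture.Cruxes.HLiu418.K2LiuWeilDatumSmoothU22` (continued).  THEOREMS ONLY (no definition, no instance, no notation,
no named fact, no `sorry`); `--supports stmt-HodgeConjecture-24832 --as helper`.

At the tree's CONSTRUCTED archimedean Weil datum `ω = weilRep ∘ toBig` of the real unitary dual pair `U(2,2) × U(R,S)` (★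
`JunctionWeilDatumGeneralRank.isArchWeilDatum_weilRepPair` — (w1) strong continuity, (w2) Heisenberg covariance, (w2′) unitary lifts, NO HYPOTHESIS —
with the vacuum clause ★ `weilRepPair_κ_hermitePi_zero` = [KonnoKonno2007, Lemma 5.2]: exponents `(−|S|, −|R|, −2, −2)`), the two heads of (G2-W2) hold
UNCONDITIONALLY: **`contDiffAt_weilRepPair_inl`** (`x ↦ T (ω (c x, 1) Φ)` is `C^∞` for matrix-smooth `c : B → U(2,2)`) and
**`hasDerivAt_weilRepPair_expMem_smul_u22X`** (the sixteen letter derivatives with explicit Schwartz derivative vectors).  This is the datum the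
archimedean factorisation ★ `IsArchWeilDatum.exists_circle_twist_factorisation_clm` twists by a continuous circle character when the archimedean block of
#42F′'s doubled Weil representation is read at one real place (the bridge, sub-organ G2-W4).

HONEST LABEL: HC_CM is proved only modulo the 7 printed citations (2 remaining named inputs: hLiu418 = stmt-HodgeConjecture-24832, h413 =
stmt-HodgeConjecture-24833) until rung 0 closes; organ capital for #42F′'s Road I, moves no counter.

## References
* [KonnoKonno2007] K. Konno, T. Konno, Kyushu J. Math. 61 (2007), §3.3, Lemma 5.2.
* [Folland1989] G. B. Folland, *Harmonic Analysis in Phase Space* (1989), §4.2, (4.24), Prop. (4.39).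
* [Varadarajan1984] V. S. Varadarajan, *Lie Groups, Lie Algebras, and Their Representations* (1984), Thm. 2.10.1.
-/

set_option autoImplicit false
set_option linter.dupNamespace false

noncomputable section

open scoped MatrixGroups Matrix Topology SchwartzMap Matrix.Norms.Operator
open Filter
open Literature.NumberTheory.Automorphic Literature.Analysis.SegalBargmann Literature.NumberTheory.Weil1964
open Literature.RepresentationTheory.KonnoKonno2007 hiding LetterKind letterOf letterGen letterOf_boost letterOf_torus letterOf_torus_eq
  letterGen_boost letterGen_torus letterGen_mem_lie exp_smul_letterGen
open Literature.RepresentationTheory.KonnoKonno2007.RealDualPair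
open Literature.RepresentationTheory.KonnoKonno2007.RealDualPair.UForm
open Summit.HodgeConjecture.HodgeConjecture.Cruxes.HLiu418.K2LiuU22AdaptedBasis

-- Mathlib idiom (`Mathlib/Algebra/Lie/OfAssociative.lean`), as in ★ `RealMatrixGroups` ∕ ★ `JunctionArchDifferentiable`: the commutator bracket on
-- `Matrix n n ℂ`, needed to name the Lie subalgebra `(uFormGroup (Fin 2) (Fin 2)).lie`
attribute [local instance 100] LieRing.ofAssociativeRing

namespace Summit.HodgeConjecture.HodgeConjecture.Cruxes.HLiu418.K2LiuWeilDatumSmoothU22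

/-! ## The constructed junction datum `weilRep ∘ toBig` of `U(2,2) × U(R,S)` -/

section Instance

open Literature.NumberTheory.Weil1964.UnitaryWeil

variable {R S : Type*} [Fintype R] [DecidableEq R] [Fintype S] [DecidableEq S]
  {V : Type*} [NormedAddCommGroup V] [NormedSpace ℝ V]

set_option backward.isDefEq.respectTransparency false in
/-- **Smoothness of the tree's junction Weil representation of `U(2,2) × U(R,S)` along `U(2,2)` — NO HYPOTHESIS.**  For the constructed datum
`ω = weilRep ∘ toBig` (★ `isArchWeilDatum_weilRepPair`, vacuum clause ★ `weilRepPair_κ_hermitePi_zero` with exponents `(−|S|, −|R|, −2, −2)`):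
`x ↦ T (ω (c x, 1) Φ)` is `C^∞` at `x₀` for every matrix-smooth `c : B → U(2,2)`, every continuous ℝ-linear `T : 𝓢 → V`, every `Φ`.
[cite: KonnoKonno2007, Lemma 5.2 (i)/(ii) p. 73] [cite: Varadarajan1984, Thm. 2.10.1] -/
theorem contDiffAt_weilRepPair_inl {B : Type*} [NormedAddCommGroup B] [NormedSpace ℝ B] {c : B → UForm (Fin 2) (Fin 2)} {x₀ : B}
    (hc : ContDiffAt ℝ ((⊤ : ℕ∞) : WithTop ℕ∞) (fun x => ((c x : GL (Fin 2 ⊕ Fin 2) ℂ) : Matrix (Fin 2 ⊕ Fin 2) (Fin 2 ⊕ Fin 2) ℂ)) x₀)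
    (T : (SchwartzMap (DPIdx (Fin 2) (Fin 2) R S → ℝ) ℂ) →L[ℝ] V) (Φ : SchwartzMap (DPIdx (Fin 2) (Fin 2) R S → ℝ) ℂ) :
    ContDiffAt ℝ ((⊤ : ℕ∞) : WithTop ℕ∞)
      (fun x => T ((weilRep (α := (Fin 2 × R) ⊕ (Fin 2 × S)) (β := (Fin 2 × S) ⊕ (Fin 2 × R))).comp (toBig (Fin 2) (Fin 2) R S)
        ((c x, (1 : UForm R S)) : Ginf (Fin 2) (Fin 2) R S) Φ)) x₀ :=
  contDiffAt_weilDatum_inl (isArchWeilDatum_weilRepPair (Fin 2) (Fin 2) R S) (weilRepPair_κ_hermitePi_zero) hc T Φ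

set_option backward.isDefEq.respectTransparency false in
/-- **The letter derivatives of the tree's junction Weil representation of `U(2,2) × U(R,S)` — NO HYPOTHESIS**: along the `i`-th adapted basis vector of
`𝔲(2,2)`, `d∕ds|_{s₀} T (ω (exp (s X_i), 1) Φ) = T ((u22LetterOp e k_i kind_i).deriv.op s₀ Φ)` with `e = (−|S|, −|R|, −2, −2)`.
[cite: KonnoKonno2007, Lemma 5.2 (i)/(ii) p. 73] [cite: Folland1989, (4.24), Prop. (4.39)] -/
theorem hasDerivAt_weilRepPair_expMem_smul_u22X (i : Fin 16) (T : (SchwartzMap (DPIdx (Fin 2) (Fin 2) R S → ℝ) ℂ) →L[ℝ] V)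
    (Φ : SchwartzMap (DPIdx (Fin 2) (Fin 2) R S → ℝ) ℂ) (s₀ : ℝ) :
    HasDerivAt (fun s => T ((weilRep (α := (Fin 2 × R) ⊕ (Fin 2 × S)) (β := (Fin 2 × S) ⊕ (Fin 2 × R))).comp (toBig (Fin 2) (Fin 2) R S)
        ((((uFormGroup (Fin 2) (Fin 2)).expMem (s • u22X i) : UForm (Fin 2) (Fin 2)), (1 : UForm R S)) : Ginf (Fin 2) (Fin 2) R S) Φ))
      (T ((u22LetterOp R S ⟨-(Fintype.card S : ℤ), -(Fintype.card R : ℤ), -(Fintype.card (Fin 2) : ℤ), -(Fintype.card (Fin 2) : ℤ)⟩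
        (u22FrameK i) (u22Kind i)).deriv.op s₀ Φ)) s₀ :=
  hasDerivAt_weilDatum_expMem_smul_u22X_at (isArchWeilDatum_weilRepPair (Fin 2) (Fin 2) R S) (weilRepPair_κ_hermitePi_zero) i T Φ s₀

end Instance

end Summit.HodgeConjecture.HodgeConjecture.Cruxes.HLiu418.K2LiuWeilDatumSmoothU22

end
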